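import Summits.BirchSwinnertonDyer.BirchSwinnertonDyer.Theorems.BiquadraticEisensteinDescentManinDatumSupercuspidalCMInertOfH5OfResolventBound
import Summits.BirchSwinnertonDyer.BirchSwinnertonDyer.Theorems.BiquadraticEisensteinDescentManinDatumSupercuspidalCMInertResolventCertificate
import HarnessLib

set_option linter.dupNamespace false -- `Summit.BirchSwinnertonDyer.BirchSwinnertonDyer.Theorems.…` (summit = sub, D-0017)
set_option autoImplicit false

/-!
# Crux `ManinDatumSupercuspidalCMInert` (stmt-BirchSwinnertonDyer-20111, BED r605) REDUCED TO `H₅` ALONE: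
# `H₅ → ManinDatumSupercuspidalCMInert` by name, the `j = 1728` half being the theorem `smallEvenResolventBound_seven`
# (width seat `bsd-wall-cm-bed-w3` g10; one theorem; route cone; `--supports 20111`, helper)

Route `BiquadraticEisensteinDescent` (cell `pub/bsd-wall`).  bed-w2 g10's crux-level closer
`maninDatumSupercuspidalCMInert_of_H5_of_smallEvenResolventBound : H₅ → RES₇fin → ManinDatumSupercuspidalCMInert` with its second
hypothesis DISCHARGED by this seat's certificate `…ResolventCertificate.smallEvenResolventBound_seven : RES₇fin` (p646297).  What is left of the
crux is exactly `H₅` — the plain `5`-integrality, in Néron units, of the odd twisted `L`-values of the Mordell models `y² = x³ + k` (`5 ∣ k`,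
`k` sixth-power-free) at primes `ℓ ≥ 5`, `ℓ ∤ k`, `4 ∤ ℓ − 1`, `5 ∤ ℓ − 1`, `5` a square mod `ℓ` (bed-w4 g10's plain-odd reshaping; the `j = 0`
sextic cells `II / IV / IV* / II*` of `stub_S5`).

HONEST FRAMING: `H₅` is NOT proved (road: the sextic-twist dictionary over `ℤ[ω]`, bed-w2 g11, and the `5`-division certificate, bed-w1 g8);
the crux, its parent `ManinDatumFiveSevenCMInert`, Manin's conjecture and BSD are NOT proved by this.  No definition, no named fact, no `sorry`.
-/

noncomputable section

open scoped Classical ComplexConjugate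
open Complex PeriodPair WeierstrassCurve IsDedekindDomain NumberField
open Literature.NumberTheory.EllipticCurves Literature.NumberTheory.EllipticCurves.GaussianLattice
open Literature.NumberTheory.LFunctions Literature.NumberTheory.LFunctions.GaussianTheta
open Literature.NumberTheory.QuadraticFields.GaussianQuarticSymbol
open Literature.NumberTheory.EllipticCurves.ModularForms
open Literature.NumberTheory.EllipticCurves.Rank1Residual
open Literature.NumberTheory.DiophantineGeometry
open Summit.BirchSwinnertonDyer.BirchSwinnertonDyer.Theses.BiquadraticEisensteinDescent

namespace Summit.BirchSwinnertonDyer.BirchSwinnertonDyer.Theorems.BiquadraticEisensteinDescentManinDatumSupercuspidalCMInertOfH5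

open Summit.BirchSwinnertonDyer.BirchSwinnertonDyer.Theorems.BiquadraticEisensteinDescentManinDatumSupercuspidalCMInertOfH5OfResolventBound
  (maninDatumSupercuspidalCMInert_of_H5_of_smallEvenResolventBound)
open Summit.BirchSwinnertonDyer.BirchSwinnertonDyer.Theorems.BiquadraticEisensteinDescentManinDatumSupercuspidalCMInertResolventCertificate
  (smallEvenResolventBound_seven)

/-- ★ **`H₅ → ManinDatumSupercuspidalCMInert`** (crux 20111 BY NAME): the supercuspidal Manin residual for CM curves at `p ∈ {5, 7}` follows from
the single hypothesis `H₅` (odd twisted `L`-value `5`-integrality of the Mordell models `y² = x³ + k`, `5 ∣ k`), the `p = 7` / `j = 1728` half being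
the unconditional theorem `stub_S7` (RES₇fin certificate).  Composition of bed-w2 g10's `…_of_H5_of_smallEvenResolventBound` with
`smallEvenResolventBound_seven`. [cite: Serre1979, Ch. IV §2 Prop. 7] [cite: Rubin1999, Prop. 7.15] -/
theorem maninDatumSupercuspidalCMInert_of_H5
    (H₅ : ∀ (k : ℤ), k ≠ 0 → (5 : ℤ) ∣ k → (∀ q : ℕ, q.Prime → ¬ ((q : ℤ) ^ 6 ∣ k)) →
      ∀ (ℓ : ℕ) [NeZero ℓ], ℓ.Prime → 5 ≤ ℓ → ¬ (ℓ : ℤ) ∣ k → ¬ 4 ∣ ℓ - 1 → ¬ 5 ∣ ℓ - 1 →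
        IsSquare ((5 : ℕ) : ZMod ℓ) →
      ∀ χ : DirichletCharacter ℂ ℓ, χ.Odd →
      ∃ L : ℂ → ℂ, Differentiable ℂ L ∧
        (∀ s : ℂ, 2 < s.re → L s = LSeries (fun n : ℕ ↦ χ⁻¹ (n : ZMod ℓ) *
          ((⟨0, 0, 0, 0, (k : ℚ)⟩ : WeierstrassCurve ℚ).LFunction n : ℂ)) s) ∧
        ∃ s : ℕ, ¬ 5 ∣ s ∧ IsIntegral ℤ ((s : ℂ) * (gaussSum χ (ZMod.stdAddChar (N := ℓ)) * L 1 /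
          (Complex.I * ((⟨0, 0, 0, 0, (k : ℚ)⟩ : WeierstrassCurve ℚ).imaginaryPeriodRat : ℂ))))) :
    ManinDatumSupercuspidalCMInert :=
  maninDatumSupercuspidalCMInert_of_H5_of_smallEvenResolventBound H₅ smallEvenResolventBound_seven

end Summit.BirchSwinnertonDyer.BirchSwinnertonDyer.Theorems.BiquadraticEisensteinDescentManinDatumSupercuspidalCMInertOfH5

end
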